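import Literature.NumberTheory.LFunctions.KMVMollifierDiagonalMainTerm
import Summits.Parity.GeneralizedHardyLittlewood.Theorems.BeyondDiagonalBeatsQuarter.KernelFormXSqBridge
import HarnessLib

/-!
# The diagonal of the order-`k` mollified first moment, expanded onto the weighted log-power sums `W_j(M)`
# (helper for crux K_A `PrimeLevelFamEdge.MomentsBeyondDiagonal`, stmt-Parity-20007, stub `stub_first : SubFirst` ∀`Q`)

After `…FirstOrderMollifiedK` the order-`k` mollified first moment beyond the diagonal (`1 < Δ' < 2`) is its diagonal
`q̂^{1/2} Σ_{m ≤ M} x_m m^{−1/2} 𝒱_k(log(q̂/m))`, `𝒱_k(L) = Σ_i (k choose i) Γ^{(k−i)}(1) L^i`, up to a power saving. With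
`x_m m^{−1/2} = μ(m)/(mψ(m)) · P(log(M/m)/log M)` and `log(q̂/m) = log(M/m) − a`, `a = (Δ'−1) log q̂`, each power
`(log(q̂/m))^i` re-expands binomially onto the tree's `MollifierMainTerm.weightLogPowSum j M = Σ_{m ≤ M} μ(m)/(mψ(m)) logʲ(M/m)`,
whose asymptotic `W_j(M) = ζ(2) j log^{j−1}M + O(log^{j−2}M)` (`j ≥ 2`) is `MollifierMainTerm.abs_weightLogPowSum_sub_le`:
* `diagSum_expand` — `Σ_{m ≤ M} μ(m)ψ(m)⁻¹m⁻¹ P(log(M/m)/log M)(log(M/m) − a)^i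
   = Σ_{c ≤ deg P} Σ_{b ≤ i} P_c (log M)^{−c} (i choose b)(−a)^{i−b} W_{b+c}(M)`.
Proof only; nothing about Landau–Siegel zeros; K_A NOT proved.
-/

noncomputable section

open scoped Real ArithmeticFunction.Moebius
open Finset Polynomial ArithmeticFunction
open Literature.NumberTheory.LFunctions Literature.NumberTheory.LFunctions.KMV2000
open Literature.NumberTheory.LFunctions.KMV2000.MollifierMainTerm

namespace Summit.Parity.GeneralizedHardyLittlewood.Theorems.MomentsBeyondDiagonal.FirstOrderAFE

/-- **Binomial re-expansion of the order-`k` diagonal onto `W_j(M)`**: for every real polynomial `P`, reals `M, a` and `i`,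
`Σ_{1 ≤ m ≤ M} μ(m)ψ(m)⁻¹m⁻¹ · P(log(M/m)/log M) · (log(M/m) − a)^i
 = Σ_{c ≤ deg P} Σ_{b ≤ i} P_c (log M)⁻¹^c (i choose b) (−a)^{i−b} W_{b+c}(M)`. [cite: KowalskiMichelVanderKam2000, §4.1 (19)–(20)] -/
theorem diagSum_expand (P : ℝ[X]) (M a : ℝ) (i : ℕ) :
    ∑ m ∈ Icc 1 ⌊M⌋₊, (μ m : ℝ) * ((psi m)⁻¹ * (m : ℝ)⁻¹) * P.eval (Real.log (M / m) / Real.log M) *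
        (Real.log (M / m) - a) ^ i =
      ∑ c ∈ range (P.natDegree + 1), ∑ b ∈ range (i + 1),
        P.coeff c * (Real.log M)⁻¹ ^ c * ((i.choose b : ℕ) : ℝ) * (-a) ^ (i - b) * weightLogPowSum (b + c) M := by
  -- per `m`: expand `P` and the binomial
  have hm : ∀ m ∈ Icc 1 ⌊M⌋₊,
      (μ m : ℝ) * ((psi m)⁻¹ * (m : ℝ)⁻¹) * P.eval (Real.log (M / m) / Real.log M) * (Real.log (M / m) - a) ^ i =
        ∑ c ∈ range (P.natDegree + 1), ∑ b ∈ range (i + 1),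
          P.coeff c * (Real.log M)⁻¹ ^ c * ((i.choose b : ℕ) : ℝ) * (-a) ^ (i - b) *
            (W m * Real.log (M / m) ^ (b + c)) := by
    intro m hmI
    have hm0 : m ≠ 0 := by have := (Finset.mem_Icc.1 hmI).1; omega
    rw [BeyondDiagonalBeatsQuarter.KernelFormXSq.W_apply'' hm0, Polynomial.eval_eq_sum_range, sub_eq_add_neg, add_pow]
    simp only [Finset.mul_sum, Finset.sum_mul]
    rw [Finset.sum_comm]
    refine Finset.sum_congr rfl fun c _ ↦ Finset.sum_congr rfl fun b _ ↦ ?_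
    rw [div_pow, pow_add]
    ring
  rw [Finset.sum_congr rfl hm, Finset.sum_comm]
  refine Finset.sum_congr rfl fun c _ ↦ ?_
  rw [Finset.sum_comm]
  refine Finset.sum_congr rfl fun b _ ↦ ?_
  rw [weightLogPowSum, Finset.mul_sum]

/-- **The derivative binomial identity** `Σ_{b ≤ i} b (i choose b) x^{b−1} y^{i−b} = i (x+y)^{i−1}` (used with `x = Δ'`,
`y = 1 − Δ'`: the `P(1)`-coefficient of the order-`k` diagonal main term is `k`). -/
theorem sum_range_mul_choose_pow_eq (x y : ℝ) (i : ℕ) :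
    ∑ b ∈ range (i + 1), (b : ℝ) * ((i.choose b : ℕ) : ℝ) * x ^ (b - 1) * y ^ (i - b) = i * (x + y) ^ (i - 1) := by
  rcases Nat.eq_zero_or_pos i with rfl | hi
  · simp
  obtain ⟨n, rfl⟩ : ∃ n, i = n + 1 := ⟨i - 1, by omega⟩
  rw [Finset.sum_range_succ', Nat.cast_zero, zero_mul, zero_mul, zero_mul, add_zero, add_pow, Finset.mul_sum]
  simp only [Nat.add_sub_cancel]
  refine Finset.sum_congr rfl fun j hj ↦ ?_
  have hj : j < n + 1 := Finset.mem_range.1 hj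
  have hchoose : ((j + 1 : ℕ) : ℝ) * (((n + 1).choose (j + 1) : ℕ) : ℝ) = ((n + 1 : ℕ) : ℝ) * ((n.choose j : ℕ) : ℝ) := by
    have h := Nat.add_one_mul_choose_eq n j
    have h' : ((n + 1 : ℕ) : ℝ) * ((n.choose j : ℕ) : ℝ) = (((n + 1).choose (j + 1) : ℕ) : ℝ) * ((j + 1 : ℕ) : ℝ) := by
      exact_mod_cast h
    linarith [h']
  push_cast at hchoose ⊢
  linear_combination (x ^ j * y ^ (n - j)) * hchoose

end Summit.Parity.GeneralizedHardyLittlewood.Theorems.MomentsBeyondDiagonal.FirstOrderAFE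

end
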